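import Literature.NumberTheory.Rogawski1990.ArchLocalWallDescentParam            -- ★ p851272 (LH1-p03 (g6)): L1 `exists_descent_box_local_param`; ED. 2 `…_on` (whole parameter set, LH5-p02)
import Literature.NumberTheory.Rogawski1990.ArchOrbFamGExtBoxDescentInRegG        -- ★ p851168 (LH7-p02 (g4)): `isCompact_setOf_exists_conj_cayleyTorus_mem` (properness of `h ↦ h·T(c)·h⁻¹` in `U(J)`)
import Literature.NumberTheory.Rogawski1990.ArchChartOrbGSplitCompactProduct        -- ★ (A1): product-of-local-quotients bookkeeping (`Measure.pi` of `quotientMeasure`s)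
import HarnessLib

/-!
# (X-core) L1^ι — THE MANY-PLACES PARAMETRIC BLOCK STEP: Harish-Chandra's wall descent at a finite family of compact-chart places, for a smooth
# FAMILY of test functions on `Π_i U(α)_{e i}` (Rogawski 1990 §4.12 Lemma 4.12.1, §8.2 pp. 119–124; Harish-Chandra–van Dijk 1970; Shelstad 1979 §4)

Topic `NumberTheory/Rogawski1990`; namespace `Literature.NumberTheory.Rogawski1990`.  THEOREMS ONLY (no `def`, no instance, no notation, no axiom, no named fact,
no `sorry`); kernel lane `--kind proof --supports stmt-HodgeConjecture-24833`.  Cell `pub/hodgecm-mathlib`, crux H413 (`stmt-HodgeConjecture-24833`), F0∕P3c line LH3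
(closer stub `stub_N9`, DIRECT ROAD `F0_P3c_StubN9Direct`), organ O-L1e-b «(I₁) AT CROSS-PLACE CORNERS MEETING A REAL WALL» (LH3-plan (g4) DEAL BY NAME 2026-09-02T12:00:29Z:
(X-core) road owner LH5-p02 (g4); hands L1^ι = this file, L2^E = F0P3b-p01 (g17) `ArchOrbFamGUnfoldedModelHeldOutFinset`, L3^E + head = LH5-p02 (g4)
`ArchOrbFamGExtBoxDescentCorners`, face-side consumer F0P3a-p02 (g21)).  Binder of record for this file's head: LH5-p02 (g4).

THE MATHEMATICS.  ★ L1 `exists_descent_box_local_param_on` (p851272 + ED. 2) is Harish-Chandra's descent at ONE compact-chart place `w₀` for a smooth family `B(y, ·)`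
of test functions on `U(α)_{w₀}`, the parameter `y` ranging over an arbitrary subset `O` of a finite-dimensional real normed space `P` on which the `g`-support is
uniform.  Because the parameter space is arbitrary, the descent ITERATES: for a finite family of compact-chart places `e : ι → W` (no injectivity needed — the factors
are abstract) and a smooth family `B(y, ·) = Ξ(y, ↑↑·)` on the PRODUCT `Π_i U(α)_{e i}` with uniform compact support over `O`, the product of the local orbital
integrals at the wall points `γ_i(cw_i) = gprimeBlockAt α (e i) S (cw i)` — read over the PRODUCT OF THE LOCAL QUOTIENTS `Π_i (U(α)_{e i} ⧸ T′_{S,e i})` against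
`⊗_i (ν_i ∕ t_i)` exactly as ★ (A1) §1 `chartOrbG_eq_prod_mul_integral_pi` reads all places — equals
`K · ∫_{U(J)^ι} f((y, cw), (h_i · P diag(e^{i cw_i 0}, e^{i cw_i 2}) P⁻¹ · h_i⁻¹)_i) d μ₀^{⊗ι}` near the corner `x₀` (`e^{i x₀_i 0} = e^{i x₀_i 2} ≠ e^{i x₀_i 1}` for every `i`),
for ONE jointly smooth `f`, compactly supported in the matrix variables uniformly and depending on each `cw_i` only through `cw_i 1`.
* §0 generic bookkeeping: smooth cut-offs equal to `1` on a compact set (`ContDiffBump`), `Fin.insertNth` applied coordinatewise, Fubini along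
  `MeasurableEquiv.piFinSuccAbove` (one factor of a finite product of measures taken INSIDE).
* §1 **`exists_descent_box_local_param_fin`** — places indexed by `Fin m`, by induction on `m`: the empty product (`Measure.pi_of_empty`); then, innermost place
  first, ★ L1 `…_on` at the place `e 0` with the outer conjugates riding in the parameter space `P × M₃(ℂ)^{Fin m}` (a cut-off `= 1` on the support in the
  descended variable keeps the compact support uniform and the family pointwise equal to `B`), Fubini, then the induction hypothesis at the places
  `e ∘ Fin.succAbove 0` with the descended matrix variable riding in `(P × ℝ³) × M₂(ℂ)` and a cut-off in the outer conjugates; the integrability inputs are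
  Harish-Chandra's compactness ★ `uniformlyProper_gprimeBlock_cpt_of_injective` place by place and ★ `isCompact_setOf_exists_conj_cayleyTorus_mem` in `U(J)`.
* §2 **`exists_descent_box_local_param_pi`** — an arbitrary `Fintype ι`, transported from §1 along `Fintype.equivFin` (`MeasurableEquiv.piCongrLeft`,
  `measurePreserving_piCongrLeft`; the symmetric direction of `Equiv.piCongrLeft` is cast-free).
HONEST LABEL: HC_CM is proved only modulo the 7 printed citations (2 remaining: hLiu418 = `stmt-HodgeConjecture-24832`, h413 = `stmt-HodgeConjecture-24833`) until rung 0
closes; count-neutral letter-L1 plumbing.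

## References
* [Rogawski1990] J. D. Rogawski, *Automorphic Representations of Unitary Groups in Three Variables*, Ann. of Math. Stud. 123 (1990), §4.12 Lemma 4.12.1 p. 61, §8.2 pp. 119–124.
* [HarishChandra1970] Harish-Chandra (notes by G. van Dijk), *Harmonic Analysis on Reductive p-adic Groups*, LNM 162 (1970), Part V §4.
* [Shelstad1979] D. Shelstad, *Characters and inner forms of a quasi-split group over ℝ*, Compositio Math. 39 (1979), §4 pp. 22–25.
* [Folland1995] G. B. Folland, *A Course in Abstract Harmonic Analysis* (1995), §2.2 (product measures), §2.6 (2.52).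
-/

set_option autoImplicit false

noncomputable section

open MeasureTheory MeasureTheory.Measure NumberField NumberField.InfinitePlace NumberField.mixedEmbedding Matrix Complex Set Filter Topology
open scoped MatrixGroups Matrix Real Classical ENNReal NNReal ContDiff Matrix.Norms.Operator Pointwise
open Literature.NumberTheory.Automorphic Literature.NumberTheory.Automorphic.UnitaryGroup Literature.NumberTheory.Automorphic.ArchCartan
open Literature.NumberTheory.GaloisRepresentations Literature.MeasureTheory.Group Literature.LinearAlgebra.Matrix

namespace Literature.NumberTheory.Rogawski1990

/-! ## §0 Generic bookkeeping -/

section Generic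

/-- **A smooth cut-off equal to `1` on a compact set** of a finite-dimensional real normed space: `ψ` smooth, `ψ = 1` on `K`, and `ψ x ≠ 0` only inside the closed
ball of radius `R` about `0` (a `ContDiffBump` centred at `0` whose inner ball contains `K`). [cite: Folland1995, §2.2] -/
theorem exists_contDiff_cutoff_eq_one_of_isCompact {E : Type*} [NormedAddCommGroup E] [NormedSpace ℝ E] [FiniteDimensional ℝ E] {K : Set E} (hK : IsCompact K) :
    ∃ (ψ : E → ℝ) (R : ℝ), ContDiff ℝ ∞ ψ ∧ (∀ x, ψ x ≠ 0 → ‖x‖ ≤ R) ∧ ∀ x ∈ K, ψ x = 1 := by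
  obtain ⟨R, hR⟩ := (Metric.isBounded_iff_subset_closedBall (0 : E)).1 hK.isBounded
  let b : ContDiffBump (0 : E) := ⟨|R| + 1, |R| + 2, by positivity, by linarith⟩
  refine ⟨b, |R| + 2, b.contDiff, fun x hx => ?_, fun x hx => b.one_of_mem_closedBall ?_⟩
  · by_contra h
    exact hx (b.zero_of_le_dist (by rw [dist_zero_right]; exact (not_le.1 h).le))
  · rw [Metric.mem_closedBall, dist_zero_right]
    have h := hR hx
    rw [Metric.mem_closedBall, dist_zero_right] at h
    linarith [le_abs_self R]

/-- `Fin.insertNth` commutes with a map applied coordinatewise. [folklore] -/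
private theorem pi_apply_insertNth {m : ℕ} {α β : Fin (m + 1) → Type*} (φ : ∀ k, α k → β k) (i : Fin (m + 1)) (x : α i) (p : ∀ j, α (i.succAbove j)) :
    (fun k => φ k (i.insertNth x p k)) = i.insertNth (φ i x) (fun j => φ (i.succAbove j) (p j)) := by
  funext k
  refine Fin.succAboveCases i ?_ (fun j => ?_) k
  · rw [Fin.insertNth_apply_same, Fin.insertNth_apply_same]
  · rw [Fin.insertNth_apply_succAbove, Fin.insertNth_apply_succAbove]

/-- **Fubini along `Fin.insertNth`**: for a finite product of σ-finite measures indexed by `Fin (m + 1)` and an integrable `F`, the integral over the product is the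
iterated integral with the `i`-th variable INSIDE and the remaining variables outside (`MeasurableEquiv.piFinSuccAbove` is measure preserving, then
`integral_prod_symm`). [cite: Folland1995, §2.2] -/
theorem integral_pi_eq_integral_integral_insertNth {m : ℕ} {α : Fin (m + 1) → Type*} [∀ k, MeasurableSpace (α k)] (μ : ∀ k, Measure (α k))
    [∀ k, SigmaFinite (μ k)] (i : Fin (m + 1)) {E : Type*} [NormedAddCommGroup E] [NormedSpace ℝ E] {F : (∀ k, α k) → E} (hF : Integrable F (Measure.pi μ)) :
    ∫ z, F z ∂Measure.pi μ = ∫ p : ∀ j, α (i.succAbove j), (∫ x, F (i.insertNth x p) ∂μ i) ∂Measure.pi fun j => μ (i.succAbove j) := by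
  have hΦ := measurePreserving_piFinSuccAbove μ i
  have hΦs := hΦ.symm (MeasurableEquiv.piFinSuccAbove α i)
  rw [← hΦs.integral_comp' F]
  have hF' : Integrable (fun q : α i × ∀ j, α (i.succAbove j) => F ((MeasurableEquiv.piFinSuccAbove α i).symm q))
      ((μ i).prod (Measure.pi fun j => μ (i.succAbove j))) :=
    (hΦs.integrable_comp_emb (MeasurableEquiv.piFinSuccAbove α i).symm.measurableEmbedding).2 hF
  rw [integral_prod_symm _ hF']
  rfl

end Generic

/-! ## §1 Places indexed by `Fin m`: the induction -/

section LocalPi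

variable (L : Type) [Field L] [NumberField L] [IsCMField L] (α : Fin 3 → L) (S : Finset {w : InfinitePlace L // IsComplex w})
  [∀ w : {w : InfinitePlace L // IsComplex w}, MeasurableSpace ↥(archLocal L 3 (Matrix.diagonal α) w)]
  [∀ w : {w : InfinitePlace L // IsComplex w}, BorelSpace ↥(archLocal L 3 (Matrix.diagonal α) w)]
  [∀ w : {w : InfinitePlace L // IsComplex w}, LocallyCompactSpace ↥(archLocal L 3 (Matrix.diagonal α) w)]
  [∀ w : {w : InfinitePlace L // IsComplex w}, SecondCountableTopology ↥(archLocal L 3 (Matrix.diagonal α) w)]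
  [∀ w : {w : InfinitePlace L // IsComplex w}, MeasurableSpace (↥(archLocal L 3 (Matrix.diagonal α) w) ⧸ chartTorusGLoc L α w S)]
  [∀ w : {w : InfinitePlace L // IsComplex w}, BorelSpace (↥(archLocal L 3 (Matrix.diagonal α) w) ⧸ chartTorusGLoc L α w S)]
  (ν₀ : ∀ w : {w : InfinitePlace L // IsComplex w}, Measure ↥(archLocal L 3 (Matrix.diagonal α) w)) [∀ w, (ν₀ w).IsHaarMeasure] [∀ w, (ν₀ w).IsMulRightInvariant]
  (t₀ : ∀ w : {w : InfinitePlace L // IsComplex w}, Measure ↥(chartTorusGLoc L α w S)) [∀ w, (t₀ w).IsHaarMeasure] [∀ w, (t₀ w).IsInvInvariant]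

set_option maxHeartbeats 1600000 in
/-- **(X-core) L1 over `Fin m` — HARISH-CHANDRA'S WALL DESCENT AT `m` COMPACT-CHART PLACES FOR A SMOOTH FAMILY ON THE PRODUCT GROUP** (induction on `m` over ★ L1
`exists_descent_box_local_param_on`; statement = `exists_descent_box_local_param_pi` with `ι := Fin m`, everything after the `U(J)` data universally quantified so
that the induction hypothesis is available for ARBITRARY parameter spaces). [cite: Rogawski1990, §4.12 Lemma 4.12.1 p. 61; §8.2 pp. 119–124]
[cite: HarishChandra1970, Part V §4] [cite: Shelstad1979, §4 pp. 22–25] [cite: Folland1995, §2.6 (2.52)] -/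
theorem exists_descent_box_local_param_fin (hα : ∀ i, α i ≠ 0)
    {J : Matrix (Fin 2) (Fin 2) ℂ} (hJ : J = (StdForm.antidiagonal 2).over ℂ)
    [MeasurableSpace ↥(unitaryGroupOfForm (starRingEnd ℂ) J)] [BorelSpace ↥(unitaryGroupOfForm (starRingEnd ℂ) J)]
    [LocallyCompactSpace ↥(unitaryGroupOfForm (starRingEnd ℂ) J)] [SecondCountableTopology ↥(unitaryGroupOfForm (starRingEnd ℂ) J)]
    (μ₀ : Measure ↥(unitaryGroupOfForm (starRingEnd ℂ) J)) [μ₀.IsHaarMeasure] [μ₀.IsMulRightInvariant] :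
    ∀ (m : ℕ) (e : Fin m → {w : InfinitePlace L // IsComplex w}),
      (∀ (k : Fin m) (j : Fin 3), ((e k).1.embedding (α j)).im = 0) → (∀ k, e k ∉ S) → (∀ k, e k ∈ splitChartPlaces L α) →
      ∀ (x₀ : Fin m → Fin 3 → ℝ), (∀ k, x₀ k 0 = x₀ k 2) → (∀ k, Circle.exp (x₀ k 1) ≠ Circle.exp (x₀ k 0)) →
      ∀ {P : Type} [NormedAddCommGroup P] [NormedSpace ℝ P] [FiniteDimensional ℝ P] (O : Set P)
        (B : P → (∀ k, ↥(archLocal L 3 (Matrix.diagonal α) (e k))) → ℂ) (Ξ : P × (Fin m → Matrix (Fin 3) (Fin 3) ℂ) → ℂ),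
        ContDiff ℝ ∞ Ξ → (∀ y g, B y g = Ξ (y, fun k => ((g k : GL (Fin 3) ℂ) : Matrix (Fin 3) (Fin 3) ℂ))) →
        (∃ C : Set (∀ k, ↥(archLocal L 3 (Matrix.diagonal α) (e k))), IsCompact C ∧ ∀ y ∈ O, ∀ g ∉ C, B y g = 0) →
        ∃ (K : ℂ) (V : Set (Fin m → Fin 3 → ℝ)) (f : (P × (Fin m → Fin 3 → ℝ)) × (Fin m → Matrix (Fin 2) (Fin 2) ℂ) → ℂ),
          K ≠ 0 ∧ IsOpen V ∧ x₀ ∈ V ∧ ContDiff ℝ ∞ f ∧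
          (∃ C : Set (Fin m → Matrix (Fin 2) (Fin 2) ℂ), IsCompact C ∧ ∀ y cw X, X ∉ C → f ((y, cw), X) = 0) ∧
          (∀ y cw X, f ((y, cw), X) = f ((y, fun k => ![0, cw k 1, 0]), X)) ∧
          ∀ y ∈ O, ∀ cw ∈ V, (∀ k, Circle.exp (cw k 0) ≠ Circle.exp (cw k 2)) →
            ∫ z : (∀ k, ↥(archLocal L 3 (Matrix.diagonal α) (e k)) ⧸ chartTorusGLoc L α (e k) S),
                B y (fun k => descConj (gprimeBlockAt L α (e k) S (cw k)) (chartTorusGLoc L α (e k) S) (forall_mem_chartTorusGLoc_comm L α (e k) S (cw k)) id (z k))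
                ∂(Measure.pi fun k => quotientMeasure (chartTorusGLoc L α (e k) S) (t₀ (e k)) (isClosed_chartTorusGLoc L α (e k) S) (ν₀ (e k))) =
              K * ∫ h : Fin m → ↥(unitaryGroupOfForm (starRingEnd ℂ) J),
                f ((y, cw), fun k => (((h k * ⟨Matrix.GeneralLinearGroup.mkOfDetNeZero !![(1 : ℂ), 1; 1, -1] det_cayleyTwo_ne_zero *
                    circleDiagonal 2 ![Circle.exp (cw k 0), Circle.exp (cw k 2)] *
                    (Matrix.GeneralLinearGroup.mkOfDetNeZero !![(1 : ℂ), 1; 1, -1] det_cayleyTwo_ne_zero)⁻¹,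
                  cayley_conj_circleDiagonal_mem_of_eq_over hJ _⟩ * (h k)⁻¹ : ↥(unitaryGroupOfForm (starRingEnd ℂ) J)) : GL (Fin 2) ℂ) : Matrix (Fin 2) (Fin 2) ℂ))
                ∂(Measure.pi fun _ => μ₀) := by
  -- instances on the local quotients and their quotient measures (as in ★ (A1))
  haveI : ∀ w : {w : InfinitePlace L // IsComplex w}, IsClosed (chartTorusGLoc L α w S : Set ↥(archLocal L 3 (Matrix.diagonal α) w)) :=
    fun w => isClosed_chartTorusGLoc L α w S
  haveI : ∀ w : {w : InfinitePlace L // IsComplex w}, SecondCountableTopology (↥(archLocal L 3 (Matrix.diagonal α) w) ⧸ chartTorusGLoc L α w S) :=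
    fun w => inferInstance
  haveI hσ : ∀ w : {w : InfinitePlace L // IsComplex w},
      SigmaFinite (quotientMeasure (chartTorusGLoc L α w S) (t₀ w) (isClosed_chartTorusGLoc L α w S) (ν₀ w)) := fun w => inferInstance
  -- the closed embedding `U(J) ↪ M₂(ℂ)` is not needed; `h ↦ ↑↑(h T(cw) h⁻¹)` is continuous
  have hXc : ∀ cw : Fin 3 → ℝ, Continuous fun h : ↥(unitaryGroupOfForm (starRingEnd ℂ) J) =>
      (((h * ⟨Matrix.GeneralLinearGroup.mkOfDetNeZero !![(1 : ℂ), 1; 1, -1] det_cayleyTwo_ne_zero *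
          circleDiagonal 2 ![Circle.exp (cw 0), Circle.exp (cw 2)] *
          (Matrix.GeneralLinearGroup.mkOfDetNeZero !![(1 : ℂ), 1; 1, -1] det_cayleyTwo_ne_zero)⁻¹,
        cayley_conj_circleDiagonal_mem_of_eq_over hJ _⟩ * h⁻¹ : ↥(unitaryGroupOfForm (starRingEnd ℂ) J)) : GL (Fin 2) ℂ) : Matrix (Fin 2) (Fin 2) ℂ) :=
    fun cw => Units.continuous_val.comp (continuous_subtype_val.comp ((continuous_id.mul continuous_const).mul continuous_id.inv))
  -- properness of `h ↦ h T(cw) h⁻¹` in `U(J)` off the wall (★ `isCompact_setOf_exists_conj_cayleyTorus_mem` with the one-point coordinate set `{fun _ => cw}`)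
  have hXprop : ∀ (w₀ : {w : InfinitePlace L // IsComplex w}) (cw : Fin 3 → ℝ), Circle.exp (cw 0) ≠ Circle.exp (cw 2) →
      ∀ C : Set (Matrix (Fin 2) (Fin 2) ℂ), IsCompact C →
        IsCompact {h : ↥(unitaryGroupOfForm (starRingEnd ℂ) J) |
          (((h * ⟨Matrix.GeneralLinearGroup.mkOfDetNeZero !![(1 : ℂ), 1; 1, -1] det_cayleyTwo_ne_zero *
              circleDiagonal 2 ![Circle.exp (cw 0), Circle.exp (cw 2)] *
              (Matrix.GeneralLinearGroup.mkOfDetNeZero !![(1 : ℂ), 1; 1, -1] det_cayleyTwo_ne_zero)⁻¹,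
            cayley_conj_circleDiagonal_mem_of_eq_over hJ _⟩ * h⁻¹ : ↥(unitaryGroupOfForm (starRingEnd ℂ) J)) : GL (Fin 2) ℂ) : Matrix (Fin 2) (Fin 2) ℂ) ∈ C} := by
    intro w₀ cw hcw C hC
    have h := isCompact_setOf_exists_conj_cayleyTorus_mem L w₀ hJ (K := {fun _ => cw}) isCompact_singleton (fun c hc => by
      rw [Set.mem_singleton_iff.1 hc]; exact hcw) hC
    refine h.of_isClosed_subset (hC.isClosed.preimage (hXc cw)) fun h hh => ⟨fun _ => cw, Set.mem_singleton _, hh⟩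
  intro m
  induction m with
  | zero =>
    intro e hreal he hesp x₀ hx02 hx1 P _ _ _ O B Ξ hΞ hBΞ hBsupp
    refine ⟨1, Set.univ, fun q => Ξ (q.1.1, fun k => isEmptyElim k), one_ne_zero, isOpen_univ, Set.mem_univ _,
      hΞ.comp ((contDiff_fst.comp contDiff_fst).prodMk contDiff_const), ⟨Set.univ, isCompact_univ, fun y cw X hX => (hX (Set.mem_univ _)).elim⟩,
      fun y cw X => rfl, fun y hy cw hcw hreg => ?_⟩
    have h1 : (fun z : (∀ k : Fin 0, ↥(archLocal L 3 (Matrix.diagonal α) (e k)) ⧸ chartTorusGLoc L α (e k) S) =>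
        B y (fun k => descConj (gprimeBlockAt L α (e k) S (cw k)) (chartTorusGLoc L α (e k) S) (forall_mem_chartTorusGLoc_comm L α (e k) S (cw k)) id (z k))) =
        fun _ => Ξ (y, fun k => isEmptyElim k) := by
      funext z
      rw [hBΞ]
      exact congrArg (fun U => Ξ (y, U)) (funext fun k => isEmptyElim k)
    have h2 : (fun h : Fin 0 → ↥(unitaryGroupOfForm (starRingEnd ℂ) J) =>
        (fun q : (P × (Fin 0 → Fin 3 → ℝ)) × (Fin 0 → Matrix (Fin 2) (Fin 2) ℂ) => Ξ (q.1.1, fun k => isEmptyElim k))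
          ((y, cw), fun k => (((h k * ⟨Matrix.GeneralLinearGroup.mkOfDetNeZero !![(1 : ℂ), 1; 1, -1] det_cayleyTwo_ne_zero *
              circleDiagonal 2 ![Circle.exp (cw k 0), Circle.exp (cw k 2)] *
              (Matrix.GeneralLinearGroup.mkOfDetNeZero !![(1 : ℂ), 1; 1, -1] det_cayleyTwo_ne_zero)⁻¹,
            cayley_conj_circleDiagonal_mem_of_eq_over hJ _⟩ * (h k)⁻¹ : ↥(unitaryGroupOfForm (starRingEnd ℂ) J)) : GL (Fin 2) ℂ) : Matrix (Fin 2) (Fin 2) ℂ))) =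
        fun _ => Ξ (y, fun k => isEmptyElim k) := rfl
    rw [h1, h2, Measure.pi_of_empty, Measure.pi_of_empty, integral_const, integral_const, probReal_univ, probReal_univ, one_smul, one_mul]
  | succ m ih =>
    intro e hreal he hesp x₀ hx02 hx1 P _ _ _ O B Ξ hΞ hBΞ hBsupp
    obtain ⟨C, hC, hBC⟩ := hBsupp
    /- ### abbreviations (local definitions): the Cayley torus point `Tc cw`, its conjugates `Xof cw h`, the local orbit maps `cj k`, the matrices of the
      outer conjugates `Uof z'`, the local quotient measures `qμ k`, the tangential coordinate `Tg c = (0, c 1, 0)` -/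
    let Tc : (Fin 3 → ℝ) → ↥(unitaryGroupOfForm (starRingEnd ℂ) J) := fun cw =>
      ⟨Matrix.GeneralLinearGroup.mkOfDetNeZero !![(1 : ℂ), 1; 1, -1] det_cayleyTwo_ne_zero * circleDiagonal 2 ![Circle.exp (cw 0), Circle.exp (cw 2)] *
          (Matrix.GeneralLinearGroup.mkOfDetNeZero !![(1 : ℂ), 1; 1, -1] det_cayleyTwo_ne_zero)⁻¹, cayley_conj_circleDiagonal_mem_of_eq_over hJ _⟩
    let Xof : (Fin 3 → ℝ) → ↥(unitaryGroupOfForm (starRingEnd ℂ) J) → Matrix (Fin 2) (Fin 2) ℂ := fun cw h =>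
      (((h * Tc cw * h⁻¹ : ↥(unitaryGroupOfForm (starRingEnd ℂ) J)) : GL (Fin 2) ℂ) : Matrix (Fin 2) (Fin 2) ℂ)
    let Tg : (Fin 3 → ℝ) → Fin 3 → ℝ := fun c => ![0, c 1, 0]
    let coeM : ∀ k : Fin (m + 1), ↥(archLocal L 3 (Matrix.diagonal α) (e k)) → Matrix (Fin 3) (Fin 3) ℂ := fun k g => ((g : GL (Fin 3) ℂ) : Matrix (Fin 3) (Fin 3) ℂ)
    let qμ : ∀ k : Fin (m + 1), Measure (↥(archLocal L 3 (Matrix.diagonal α) (e k)) ⧸ chartTorusGLoc L α (e k) S) := fun k =>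
      quotientMeasure (chartTorusGLoc L α (e k) S) (t₀ (e k)) (isClosed_chartTorusGLoc L α (e k) S) (ν₀ (e k))
    -- continuity of `Xof cw` and of `Tg`, idempotence of `Tg`
    have hXofc : ∀ cw, Continuous (Xof cw) := fun cw => hXc cw
    have hTs : ContDiff ℝ ∞ Tg := by
      refine contDiff_pi.2 fun i => ?_
      fin_cases i
      · exact contDiff_const
      · exact contDiff_apply ℝ ℝ (1 : Fin 3)
      · exact contDiff_const
    have hTT : ∀ c : Fin 3 → ℝ, Tg (Tg c) = Tg c := fun c => by simp [Tg]
    -- the closed embeddings `U(α)_{e k} ↪ M₃(ℂ)`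
    have hemb : ∀ k : Fin (m + 1), IsClosedEmbedding (coeM k) := by
      intro k
      have hD : (Matrix.diagonal α).map (e k).1.embedding = Matrix.diagonal fun i => ((formRe L α (e k) i : ℝ) : ℂ) :=
        diagonal_map_embedding_eq_of_real (hreal k)
      have hdet : ((Matrix.diagonal α).map (e k).1.embedding).det ≠ 0 := by
        rw [hD, Matrix.det_diagonal]
        exact Finset.prod_ne_zero_iff.2 fun i _ => by exact_mod_cast formRe_ne_zero hα (hreal k) i
      exact isClosedEmbedding_coe_unitaryGroupOfForm _ hdet
    have hcoec : ∀ k : Fin (m + 1), Continuous (coeM k) := fun k => (hemb k).continuous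
    -- `B y` is continuous
    have hBc : ∀ y, Continuous (B y) := fun y => by
      have h : B y = fun g => Ξ (y, fun k => coeM k (g k)) := funext fun g => hBΞ y g
      rw [h]
      exact hΞ.continuous.comp (continuous_const.prodMk (continuous_pi fun k => (hcoec k).comp (continuous_apply k)))
    /- ### the cut-offs: `ψ₀` in the descended variable (`= 1` on the `e 0`-shadow of the support `C`), `χ` in the outer conjugates (`= 1` on the
      `e'`-shadow of `C`) -/
    obtain ⟨ψ₀, R₀, hψ₀s, hψ₀R, hψ₀1⟩ := exists_contDiff_cutoff_eq_one_of_isCompact ((hC.image (continuous_apply (0 : Fin (m + 1)))).image (hcoec 0))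
    have htailc : Continuous fun g : ∀ k : Fin (m + 1), ↥(archLocal L 3 (Matrix.diagonal α) (e k)) => fun j : Fin m => coeM _ (g ((0 : Fin (m + 1)).succAbove j)) :=
      continuous_pi fun j => (hcoec _).comp (continuous_apply _)
    obtain ⟨χ, Rχ, hχs, hχR, hχ1⟩ := exists_contDiff_cutoff_eq_one_of_isCompact (hC.image htailc)
    /- ### the family at the place `e 0` with the outer conjugates as parameters: `Ξ₁((y, U), X) = ψ₀(X) · Ξ(y, insertNth 0 X U)`, `B₁(y, U)(g) = Ξ₁((y, U), ↑↑g)` -/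
    have hins : ContDiff ℝ ∞ fun q : (P × (Fin m → Matrix (Fin 3) (Fin 3) ℂ)) × Matrix (Fin 3) (Fin 3) ℂ =>
        (Fin.insertNth (0 : Fin (m + 1)) q.2 q.1.2 : Fin (m + 1) → Matrix (Fin 3) (Fin 3) ℂ) := by
      refine contDiff_pi.2 fun k => Fin.succAboveCases (0 : Fin (m + 1)) ?_ (fun j => ?_) k
      · have h : (fun q : (P × (Fin m → Matrix (Fin 3) (Fin 3) ℂ)) × Matrix (Fin 3) (Fin 3) ℂ =>
            (Fin.insertNth (0 : Fin (m + 1)) q.2 q.1.2 : Fin (m + 1) → Matrix (Fin 3) (Fin 3) ℂ) 0) = fun q => q.2 :=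
          funext fun q => Fin.insertNth_apply_same _ _ _
        rw [h]; exact contDiff_snd
      · have h : (fun q : (P × (Fin m → Matrix (Fin 3) (Fin 3) ℂ)) × Matrix (Fin 3) (Fin 3) ℂ =>
            (Fin.insertNth (0 : Fin (m + 1)) q.2 q.1.2 : Fin (m + 1) → Matrix (Fin 3) (Fin 3) ℂ) ((0 : Fin (m + 1)).succAbove j)) = fun q => q.1.2 j :=
          funext fun q => Fin.insertNth_apply_succAbove _ _ _ _
        rw [h]; exact (contDiff_apply ℝ (Matrix (Fin 3) (Fin 3) ℂ) j).comp (contDiff_snd.comp contDiff_fst)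
    let Ξ₁ : (P × (Fin m → Matrix (Fin 3) (Fin 3) ℂ)) × Matrix (Fin 3) (Fin 3) ℂ → ℂ := fun q =>
      ((ψ₀ q.2 : ℝ) : ℂ) * Ξ (q.1.1, Fin.insertNth (0 : Fin (m + 1)) q.2 q.1.2)
    let B₁ : P × (Fin m → Matrix (Fin 3) (Fin 3) ℂ) → ↥(archLocal L 3 (Matrix.diagonal α) (e 0)) → ℂ := fun y' g => Ξ₁ (y', coeM 0 g)
    have hΞ₁s : ContDiff ℝ ∞ Ξ₁ :=
      (Complex.ofRealCLM.contDiff.comp (hψ₀s.comp contDiff_snd)).mul (hΞ.comp ((contDiff_fst.comp contDiff_fst).prodMk hins))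
    -- its compact `g`-support, uniform over ALL parameters `(y, U) ∈ O ×ˢ univ`
    have hB₁supp : ∃ C₁ : Set ↥(archLocal L 3 (Matrix.diagonal α) (e 0)), IsCompact C₁ ∧
        ∀ y' ∈ O ×ˢ (Set.univ : Set (Fin m → Matrix (Fin 3) (Fin 3) ℂ)), ∀ g ∉ C₁, B₁ y' g = 0 := by
      refine ⟨coeM 0 ⁻¹' Metric.closedBall 0 R₀, (hemb 0).isCompact_preimage (isCompact_closedBall _ _), fun y' _ g hg => ?_⟩
      have h0 : ψ₀ (coeM 0 g) = 0 := by
        by_contra h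
        exact hg (by rw [Set.mem_preimage, Metric.mem_closedBall, dist_zero_right]; exact hψ₀R _ h)
      show ((ψ₀ (coeM 0 g) : ℝ) : ℂ) * _ = 0
      rw [h0, Complex.ofReal_zero, zero_mul]
    -- POINTWISE: on group points the new family IS `B` with the place `e 0` inserted (`ψ₀ = 1` on the support, both vanish off it)
    have hB₁agree : ∀ y ∈ O, ∀ (u : ∀ j : Fin m, ↥(archLocal L 3 (Matrix.diagonal α) (e ((0 : Fin (m + 1)).succAbove j))))
        (g : ↥(archLocal L 3 (Matrix.diagonal α) (e 0))), B₁ (y, fun j => coeM _ (u j)) g = B y (Fin.insertNth (0 : Fin (m + 1)) g u) := by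
      intro y hy u g
      have hnat := pi_apply_insertNth coeM (0 : Fin (m + 1)) g u
      show ((ψ₀ (coeM 0 g) : ℝ) : ℂ) * Ξ (y, Fin.insertNth (0 : Fin (m + 1)) (coeM 0 g) (fun j => coeM _ (u j))) = _
      rw [← hnat, ← hBΞ]
      by_cases hgu : Fin.insertNth (0 : Fin (m + 1)) g u ∈ C
      · have hmem : coeM 0 g ∈ coeM 0 '' ((fun g : ∀ k, ↥(archLocal L 3 (Matrix.diagonal α) (e k)) => g 0) '' C) :=
          ⟨_, ⟨_, hgu, rfl⟩, by simp only [Fin.insertNth_apply_same]⟩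
        rw [hψ₀1 _ hmem, Complex.ofReal_one, one_mul]
      · rw [hBC y hy _ hgu, mul_zero]
    /- ### ★ L1 (`…_on` edition) AT THE PLACE `e 0` -/
    obtain ⟨K₁, V₀, f₁, hK₁, hV₀o, hx₀V₀, hf₁s, ⟨C₁, hC₁, hf₁C⟩, hf₁t, hid₁⟩ :=
      exists_descent_box_local_param_on L α S (e 0) (ν₀ (e 0)) (t₀ (e 0)) hα (hreal 0) hJ μ₀ (he 0) (hesp 0) (hx02 0) (hx1 0)
        (O := O ×ˢ (Set.univ : Set (Fin m → Matrix (Fin 3) (Fin 3) ℂ))) B₁ Ξ₁ hΞ₁s (fun _ _ => rfl) hB₁supp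
    /- ### the family for the induction hypothesis: `Ξ₂((((y, c), X)), U) = χ(U) · f₁(((y, U), Tg c), X)`, `B₂(y'')(u) = Ξ₂(y'', ↑↑u)` -/
    let Ξ₂ : ((P × (Fin 3 → ℝ)) × Matrix (Fin 2) (Fin 2) ℂ) × (Fin m → Matrix (Fin 3) (Fin 3) ℂ) → ℂ := fun q =>
      ((χ q.2 : ℝ) : ℂ) * f₁ (((q.1.1.1, q.2), Tg q.1.1.2), q.1.2)
    let B₂ : (P × (Fin 3 → ℝ)) × Matrix (Fin 2) (Fin 2) ℂ → (∀ j : Fin m, ↥(archLocal L 3 (Matrix.diagonal α) (e ((0 : Fin (m + 1)).succAbove j)))) → ℂ :=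
      fun y'' u => Ξ₂ (y'', fun j => coeM _ (u j))
    have hΞ₂s : ContDiff ℝ ∞ Ξ₂ := by
      refine (Complex.ofRealCLM.contDiff.comp (hχs.comp contDiff_snd)).mul (hf₁s.comp ?_)
      exact ((((contDiff_fst.comp contDiff_fst).comp contDiff_fst).prodMk contDiff_snd).prodMk
        (hTs.comp ((contDiff_snd.comp contDiff_fst).comp contDiff_fst))).prodMk (contDiff_snd.comp contDiff_fst)
    have hB₂supp : ∃ C₂ : Set (∀ j : Fin m, ↥(archLocal L 3 (Matrix.diagonal α) (e ((0 : Fin (m + 1)).succAbove j)))), IsCompact C₂ ∧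
        ∀ y'' ∈ (O ×ˢ (Set.univ : Set (Fin 3 → ℝ))) ×ˢ (Set.univ : Set (Matrix (Fin 2) (Fin 2) ℂ)), ∀ u ∉ C₂, B₂ y'' u = 0 := by
      refine ⟨Set.univ.pi fun j => coeM ((0 : Fin (m + 1)).succAbove j) ⁻¹' Metric.closedBall 0 Rχ,
        isCompact_univ_pi fun j => (hemb _).isCompact_preimage (isCompact_closedBall _ _), fun y'' _ u hu => ?_⟩
      have h0 : χ (fun j => coeM _ (u j)) = 0 := by
        by_contra h
        refine hu (Set.mem_univ_pi.2 fun j => ?_)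
        rw [Set.mem_preimage, Metric.mem_closedBall, dist_zero_right]
        exact (norm_le_pi_norm (fun j => coeM _ (u j)) j).trans (hχR _ h)
      show ((χ (fun j => coeM _ (u j)) : ℝ) : ℂ) * _ = 0
      rw [h0, Complex.ofReal_zero, zero_mul]
    /- ### THE INDUCTION HYPOTHESIS at the places `e ∘ Fin.succAbove 0` -/
    obtain ⟨K₂, V', f₂, hK₂, hV'o, hx₀V', hf₂s, ⟨C₂, hC₂, hf₂C⟩, hf₂t, hid₂⟩ :=
      ih (fun j => e ((0 : Fin (m + 1)).succAbove j)) (fun j => hreal _) (fun j => he _) (fun j => hesp _)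
        (fun j => x₀ ((0 : Fin (m + 1)).succAbove j)) (fun j => hx02 _) (fun j => hx1 _)
        (P := (P × (Fin 3 → ℝ)) × Matrix (Fin 2) (Fin 2) ℂ) ((O ×ˢ (Set.univ : Set (Fin 3 → ℝ))) ×ˢ (Set.univ : Set (Matrix (Fin 2) (Fin 2) ℂ)))
        B₂ Ξ₂ hΞ₂s (fun _ _ => rfl) hB₂supp
    /- ### the cut-off `ψ₁` in the descended variable of the place `e 0` (`= 1` on `f₁`'s matrix support `C₁`), and THE OUTPUT -/
    obtain ⟨ψ₁, R₁, hψ₁s, hψ₁R, hψ₁1⟩ := exists_contDiff_cutoff_eq_one_of_isCompact hC₁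
    -- the descended integrand `F h h'` of the output, over `U(J) × U(J)^m`
    have hinsM : Continuous fun p : Matrix (Fin 2) (Fin 2) ℂ × (Fin m → Matrix (Fin 2) (Fin 2) ℂ) =>
        (Fin.insertNth (0 : Fin (m + 1)) p.1 p.2 : Fin (m + 1) → Matrix (Fin 2) (Fin 2) ℂ) := by fun_prop
    refine ⟨K₁ * K₂,
      ((fun cw : Fin (m + 1) → Fin 3 → ℝ => cw 0) ⁻¹' V₀ ∩
        {cw | ∀ k, Circle.exp (cw k 1) ≠ Circle.exp (cw k 0) ∧ Circle.exp (cw k 1) ≠ Circle.exp (cw k 2)}) ∩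
        (fun cw : Fin (m + 1) → Fin 3 → ℝ => fun j => cw ((0 : Fin (m + 1)).succAbove j)) ⁻¹' V',
      fun q => ((ψ₁ (q.2 0) : ℝ) : ℂ) *
        f₂ ((((q.1.1, Tg (q.1.2 0)), q.2 0), fun j => q.1.2 ((0 : Fin (m + 1)).succAbove j)), fun j => q.2 ((0 : Fin (m + 1)).succAbove j)),
      mul_ne_zero hK₁ hK₂, ?_, ?_, ?_, ?_, ?_, ?_⟩
    · -- `V` is open
      refine ((hV₀o.preimage (continuous_apply _)).inter ?_).inter (hV'o.preimage (continuous_pi fun j => continuous_apply _))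
      have h : {cw : Fin (m + 1) → Fin 3 → ℝ | ∀ k, Circle.exp (cw k 1) ≠ Circle.exp (cw k 0) ∧ Circle.exp (cw k 1) ≠ Circle.exp (cw k 2)} =
          ⋂ k, ({cw | Circle.exp (cw k 1) ≠ Circle.exp (cw k 0)} ∩ {cw | Circle.exp (cw k 1) ≠ Circle.exp (cw k 2)}) := by
        ext cw; simp only [Set.mem_setOf_eq, Set.mem_iInter, Set.mem_inter_iff]
      rw [h]
      have hck : ∀ (k : Fin (m + 1)) (i : Fin 3), Continuous fun cw : Fin (m + 1) → Fin 3 → ℝ => Circle.exp (cw k i) :=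
        fun k i => Circle.exp.continuous.comp ((continuous_apply i).comp (continuous_apply k))
      exact isOpen_iInter_of_finite fun k => (isOpen_ne_fun (hck k 1) (hck k 0)).inter (isOpen_ne_fun (hck k 1) (hck k 2))
    · -- `x₀ ∈ V`
      exact ⟨⟨hx₀V₀, fun k => ⟨hx1 k, fun h => hx1 k (h.trans (congrArg Circle.exp (hx02 k)).symm)⟩⟩, hx₀V'⟩
    · -- `f` is smooth
      refine (Complex.ofRealCLM.contDiff.comp (hψ₁s.comp ((contDiff_apply ℝ (Matrix (Fin 2) (Fin 2) ℂ) (0 : Fin (m + 1))).comp contDiff_snd))).mul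
        (hf₂s.comp ?_)
      exact ((((contDiff_fst.comp contDiff_fst).prodMk (hTs.comp ((contDiff_apply ℝ (Fin 3 → ℝ) (0 : Fin (m + 1))).comp
        (contDiff_snd.comp contDiff_fst)))).prodMk ((contDiff_apply ℝ (Matrix (Fin 2) (Fin 2) ℂ) (0 : Fin (m + 1))).comp contDiff_snd)).prodMk
        (contDiff_pi.2 fun j => (contDiff_apply ℝ (Fin 3 → ℝ) _).comp (contDiff_snd.comp contDiff_fst))).prodMk
        (contDiff_pi.2 fun j => (contDiff_apply ℝ (Matrix (Fin 2) (Fin 2) ℂ) _).comp contDiff_snd)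
    · -- compact support in the matrix variables
      refine ⟨(fun p : Matrix (Fin 2) (Fin 2) ℂ × (Fin m → Matrix (Fin 2) (Fin 2) ℂ) => (Fin.insertNth (0 : Fin (m + 1)) p.1 p.2 : Fin (m + 1) → Matrix (Fin 2) (Fin 2) ℂ)) ''
          (Metric.closedBall 0 R₁ ×ˢ C₂), ((isCompact_closedBall _ _).prod hC₂).image hinsM, fun y cw X hX => ?_⟩
      dsimp only
      by_cases h0 : X 0 ∈ Metric.closedBall (0 : Matrix (Fin 2) (Fin 2) ℂ) R₁
      · have h2 : (fun j => X ((0 : Fin (m + 1)).succAbove j)) ∉ C₂ := fun h2 =>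
          hX ⟨(X 0, fun j => X ((0 : Fin (m + 1)).succAbove j)), ⟨h0, h2⟩, Fin.insertNth_self_removeNth _ _⟩
        rw [hf₂C _ _ _ h2, mul_zero]
      · have h1 : ψ₁ (X 0) = 0 := by
          by_contra h
          exact h0 (by rw [Metric.mem_closedBall, dist_zero_right]; exact hψ₁R _ h)
        rw [h1, Complex.ofReal_zero, zero_mul]
    · -- tangential
      intro y cw X
      dsimp only
      rw [hTT, hf₂t _ (fun j => cw ((0 : Fin (m + 1)).succAbove j))]
    /- ### THE IDENTITY -/
    intro y hy cw hcw hreg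
    obtain ⟨⟨hcw0, hsimple⟩, hcw'⟩ := hcw
    have hreg' : ∀ j : Fin m, Circle.exp (cw ((0 : Fin (m + 1)).succAbove j) 0) ≠ Circle.exp (cw ((0 : Fin (m + 1)).succAbove j) 2) := fun j => hreg _
    -- more abbreviations: the local orbit maps `cj k`, the matrices `Uof z'` of the outer conjugates, the final descended integrand `F`
    let cj : ∀ k : Fin (m + 1), (↥(archLocal L 3 (Matrix.diagonal α) (e k)) ⧸ chartTorusGLoc L α (e k) S) → ↥(archLocal L 3 (Matrix.diagonal α) (e k)) :=
      fun k => descConj (gprimeBlockAt L α (e k) S (cw k)) (chartTorusGLoc L α (e k) S) (forall_mem_chartTorusGLoc_comm L α (e k) S (cw k)) id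
    let Uof : (∀ j : Fin m, ↥(archLocal L 3 (Matrix.diagonal α) (e ((0 : Fin (m + 1)).succAbove j))) ⧸ chartTorusGLoc L α (e ((0 : Fin (m + 1)).succAbove j)) S) →
        Fin m → Matrix (Fin 3) (Fin 3) ℂ := fun z' j => coeM _ (cj _ (z' j))
    let F : ↥(unitaryGroupOfForm (starRingEnd ℂ) J) → (Fin m → ↥(unitaryGroupOfForm (starRingEnd ℂ) J)) → ℂ := fun h h' =>
      ((ψ₁ (Xof (cw 0) h) : ℝ) : ℂ) * f₂ ((((y, Tg (cw 0)), Xof (cw 0) h), fun j => cw ((0 : Fin (m + 1)).succAbove j)),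
        fun j => Xof (cw ((0 : Fin (m + 1)).succAbove j)) (h' j))
    have hcjc : ∀ k, Continuous (cj k) := fun k => continuous_descConj _ _ _ continuous_id
    have hUofc : Continuous Uof := continuous_pi fun j => (hcoec _).comp ((hcjc _).comp (continuous_apply j))
    -- injectivity of the angular coordinates at every place (all three eigenvalues distinct)
    have hinj : ∀ k : Fin (m + 1), Function.Injective fun i : Fin 3 => Circle.exp (cw k i) := by
      intro k i j hij
      have h01 := (hsimple k).1; have h12 := (hsimple k).2; have h02 := hreg k
      fin_cases i <;> fin_cases j
      · rfl
      · exact absurd hij.symm h01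
      · exact absurd hij h02
      · exact absurd hij h01
      · rfl
      · exact absurd hij h12
      · exact absurd hij.symm h02
      · exact absurd hij.symm h12
      · rfl
    -- Harish-Chandra's compactness at every place: the orbit map is proper modulo the local chart torus (★ `uniformlyProper_gprimeBlock_cpt_of_injective`)
    have hprop : ∀ (k : Fin (m + 1)) (D : Set ↥(archLocal L 3 (Matrix.diagonal α) (e k))), IsCompact D →
        ∃ 𝒦 : Set (↥(archLocal L 3 (Matrix.diagonal α) (e k)) ⧸ chartTorusGLoc L α (e k) S), IsCompact 𝒦 ∧ ∀ q, cj k q ∈ D → q ∈ 𝒦 := by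
      intro k D hD
      have hw : ¬ (e k ∈ S ∧ e k ∈ splitChartPlaces L α) := fun h => he k h.1
      obtain ⟨𝒦, h𝒦, hmem⟩ := uniformlyProper_gprimeBlock_cpt_of_injective L α S hα hw (chartTorusGLoc L α (e k) S) {cw k}
        (Set.singleton_subset_iff.2 (hinj k)) isCompact_singleton D hD
      refine ⟨𝒦, h𝒦, fun q hq => ?_⟩
      induction q using QuotientGroup.induction_on with
      | H g => exact hmem (cw k) (Set.mem_singleton _) g (by rw [gprimeBlock_eq_gprimeBlockAt]; exact hq)
    -- properness in `U(J)` (once for `f₁`'s support `C₁`, once for the ball carrying `ψ₁`, once for each shadow of `C₂`)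
    have hXprop' : ∀ k : Fin (m + 1), ∀ D : Set (Matrix (Fin 2) (Fin 2) ℂ), IsCompact D →
        IsCompact {h : ↥(unitaryGroupOfForm (starRingEnd ℂ) J) | Xof (cw k) h ∈ D} := fun k D hD => hXprop (e 0) (cw k) (hreg k) D hD
    /- (1)+(2): the `e 0`-variable INSIDE (Fubini along `piFinSuccAbove`; integrability from properness place by place) -/
    obtain ⟨𝒦, h𝒦c, h𝒦⟩ : ∃ 𝒦 : ∀ k : Fin (m + 1), Set (↥(archLocal L 3 (Matrix.diagonal α) (e k)) ⧸ chartTorusGLoc L α (e k) S), (∀ k, IsCompact (𝒦 k)) ∧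
        ∀ k q, cj k q ∈ (fun g : ∀ k, ↥(archLocal L 3 (Matrix.diagonal α) (e k)) => g k) '' C → q ∈ 𝒦 k := by
      choose 𝒦 h𝒦c h𝒦 using fun k => hprop k _ (hC.image (continuous_apply k))
      exact ⟨𝒦, h𝒦c, h𝒦⟩
    have hHint : Integrable (fun z : ∀ k, ↥(archLocal L 3 (Matrix.diagonal α) (e k)) ⧸ chartTorusGLoc L α (e k) S => B y (fun k => cj k (z k))) (Measure.pi qμ) := by
      refine ((hBc y).comp (continuous_pi fun k => (hcjc k).comp (continuous_apply k))).integrable_of_hasCompactSupport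
        (HasCompactSupport.of_support_subset_isCompact (isCompact_univ_pi h𝒦c) fun z hz => Set.mem_univ_pi.2 fun k => h𝒦 k _ ?_)
      have hzC : (fun k => cj k (z k)) ∈ C := by
        by_contra h; exact hz (hBC y hy _ h)
      exact ⟨_, hzC, rfl⟩
    /- (3): the inner integral is ★ L1's left-hand side for the parameter `(y, Uof z')`, hence `K₁ ∫ Ξ₂` (read at the tangential coordinate) -/
    have hinner : ∀ z' : ∀ j : Fin m, ↥(archLocal L 3 (Matrix.diagonal α) (e ((0 : Fin (m + 1)).succAbove j))) ⧸ chartTorusGLoc L α (e ((0 : Fin (m + 1)).succAbove j)) S,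
        ∫ x, B y (fun k => cj k (Fin.insertNth (α := fun k : Fin (m + 1) => ↥(archLocal L 3 (Matrix.diagonal α) (e k)) ⧸ chartTorusGLoc L α (e k) S) (0 : Fin (m + 1)) x z' k)) ∂qμ 0 = K₁ * ∫ h, Ξ₂ ((((y, Tg (cw 0)), Xof (cw 0) h)), Uof z') ∂μ₀ := by
      intro z'
      have hpt : ∀ x, (fun k => cj k (Fin.insertNth (α := fun k : Fin (m + 1) => ↥(archLocal L 3 (Matrix.diagonal α) (e k)) ⧸ chartTorusGLoc L α (e k) S) (0 : Fin (m + 1)) x z' k)) = Fin.insertNth (0 : Fin (m + 1)) (cj 0 x) (fun j => cj _ (z' j)) :=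
        fun x => pi_apply_insertNth cj (0 : Fin (m + 1)) x z'
      have hptw : ∀ x, B y (fun k => cj k (Fin.insertNth (α := fun k : Fin (m + 1) => ↥(archLocal L 3 (Matrix.diagonal α) (e k)) ⧸ chartTorusGLoc L α (e k) S) (0 : Fin (m + 1)) x z' k)) =
          descConj (gprimeBlockAt L α (e 0) S (cw 0)) (chartTorusGLoc L α (e 0) S) (forall_mem_chartTorusGLoc_comm L α (e 0) S (cw 0)) (B₁ (y, Uof z')) x := by
        intro x
        rw [hpt x, descConj_eq_comp]
        exact (hB₁agree y hy _ _).symm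
      have hL := hid₁ (y, Uof z') ⟨hy, Set.mem_univ _⟩ (cw 0) hcw0 (hreg 0)
      -- `∫ f₁(cw 0) = ∫ χ(U) f₁(Tg (Tg (cw 0)))`: `χ(U) = 1` unless the outer conjugates leave the support, in which case BOTH sides vanish
      have hvan : Uof z' ∉ (fun g : ∀ k : Fin (m + 1), ↥(archLocal L 3 (Matrix.diagonal α) (e k)) => fun j : Fin m => coeM _ (g ((0 : Fin (m + 1)).succAbove j))) '' C →
          ∫ h, f₁ (((y, Uof z'), cw 0), Xof (cw 0) h) ∂μ₀ = 0 := by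
        intro hU
        have hzero : ∀ x, B y (fun k => cj k (Fin.insertNth (α := fun k : Fin (m + 1) => ↥(archLocal L 3 (Matrix.diagonal α) (e k)) ⧸ chartTorusGLoc L α (e k) S) (0 : Fin (m + 1)) x z' k)) = 0 := by
          intro x
          rw [hpt x]
          refine hBC y hy _ fun hmem => hU ⟨_, hmem, ?_⟩
          funext j
          simp only [Fin.insertNth_apply_succAbove]
          rfl
        have hK : ∫ x, B y (fun k => cj k (Fin.insertNth (α := fun k : Fin (m + 1) => ↥(archLocal L 3 (Matrix.diagonal α) (e k)) ⧸ chartTorusGLoc L α (e k) S) (0 : Fin (m + 1)) x z' k)) ∂qμ 0 = K₁ * ∫ h, f₁ (((y, Uof z'), cw 0), Xof (cw 0) h) ∂μ₀ := by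
          rw [integral_congr_ae (Filter.Eventually.of_forall hptw)]
          exact hL
        simp_rw [hzero, integral_zero] at hK
        exact (mul_eq_zero.1 hK.symm).resolve_left hK₁
      calc ∫ x, B y (fun k => cj k (Fin.insertNth (α := fun k : Fin (m + 1) => ↥(archLocal L 3 (Matrix.diagonal α) (e k)) ⧸ chartTorusGLoc L α (e k) S) (0 : Fin (m + 1)) x z' k)) ∂qμ 0
          = ∫ x, descConj (gprimeBlockAt L α (e 0) S (cw 0)) (chartTorusGLoc L α (e 0) S) (forall_mem_chartTorusGLoc_comm L α (e 0) S (cw 0)) (B₁ (y, Uof z')) x ∂qμ 0 :=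
            integral_congr_ae (Filter.Eventually.of_forall hptw)
        _ = K₁ * ∫ h, f₁ (((y, Uof z'), cw 0), Xof (cw 0) h) ∂μ₀ := hL
        _ = K₁ * ∫ h, Ξ₂ ((((y, Tg (cw 0)), Xof (cw 0) h)), Uof z') ∂μ₀ := by
            congr 1
            by_cases hU : Uof z' ∈ (fun g : ∀ k : Fin (m + 1), ↥(archLocal L 3 (Matrix.diagonal α) (e k)) => fun j : Fin m => coeM _ (g ((0 : Fin (m + 1)).succAbove j))) '' C
            · refine integral_congr_ae (Filter.Eventually.of_forall fun h => ?_)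
              show f₁ (((y, Uof z'), cw 0), Xof (cw 0) h) = ((χ (Uof z') : ℝ) : ℂ) * f₁ (((y, Uof z'), Tg (Tg (cw 0))), Xof (cw 0) h)
              rw [hχ1 _ hU, Complex.ofReal_one, one_mul, hTT]
              exact hf₁t _ _ _
            · have hfac : ∀ h, Ξ₂ ((((y, Tg (cw 0)), Xof (cw 0) h)), Uof z') = ((χ (Uof z') : ℝ) : ℂ) * f₁ (((y, Uof z'), cw 0), Xof (cw 0) h) := by
                intro h
                show ((χ (Uof z') : ℝ) : ℂ) * f₁ (((y, Uof z'), Tg (Tg (cw 0))), Xof (cw 0) h) = _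
                rw [hTT]
                exact (congrArg (fun t => ((χ (Uof z') : ℝ) : ℂ) * t) (hf₁t _ _ _)).symm
              simp_rw [hfac, integral_const_mul, hvan hU, mul_zero]
    /- (4): the Fubini swap of the outer quotient integral with the `U(J)`-integral (cut-off `χ` + properness at the places `e'`, properness in `U(J)`) -/
    have hswap_int : Integrable (Function.uncurry fun
        (z' : ∀ j : Fin m, ↥(archLocal L 3 (Matrix.diagonal α) (e ((0 : Fin (m + 1)).succAbove j))) ⧸ chartTorusGLoc L α (e ((0 : Fin (m + 1)).succAbove j)) S)
        (h : ↥(unitaryGroupOfForm (starRingEnd ℂ) J)) => Ξ₂ ((((y, Tg (cw 0)), Xof (cw 0) h)), Uof z'))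
        ((Measure.pi fun j => qμ ((0 : Fin (m + 1)).succAbove j)).prod μ₀) := by
      obtain ⟨𝒦', h𝒦'c, h𝒦'⟩ : ∃ 𝒦' : ∀ j : Fin m, Set (↥(archLocal L 3 (Matrix.diagonal α) (e ((0 : Fin (m + 1)).succAbove j))) ⧸
          chartTorusGLoc L α (e ((0 : Fin (m + 1)).succAbove j)) S), (∀ j, IsCompact (𝒦' j)) ∧
          ∀ j q, cj _ q ∈ coeM ((0 : Fin (m + 1)).succAbove j) ⁻¹' Metric.closedBall 0 Rχ → q ∈ 𝒦' j := by
        choose 𝒦' h𝒦'c h𝒦' using fun j : Fin m =>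
          hprop ((0 : Fin (m + 1)).succAbove j) _ ((hemb _).isCompact_preimage (isCompact_closedBall (0 : Matrix (Fin 3) (Fin 3) ℂ) Rχ))
        exact ⟨𝒦', h𝒦'c, h𝒦'⟩
      refine Continuous.integrable_of_hasCompactSupport ?_
        (HasCompactSupport.of_support_subset_isCompact ((isCompact_univ_pi h𝒦'c).prod (hXprop' 0 C₁ hC₁)) ?_)
      · show Continuous fun p : (∀ j : Fin m, ↥(archLocal L 3 (Matrix.diagonal α) (e ((0 : Fin (m + 1)).succAbove j))) ⧸
            chartTorusGLoc L α (e ((0 : Fin (m + 1)).succAbove j)) S) × ↥(unitaryGroupOfForm (starRingEnd ℂ) J) =>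
            ((χ (Uof p.1) : ℝ) : ℂ) * f₁ (((y, Uof p.1), Tg (Tg (cw 0))), Xof (cw 0) p.2)
        exact (Complex.continuous_ofReal.comp (hχs.continuous.comp (hUofc.comp continuous_fst))).mul (hf₁s.continuous.comp
          (((continuous_const.prodMk (hUofc.comp continuous_fst)).prodMk continuous_const).prodMk ((hXofc (cw 0)).comp continuous_snd)))
      · intro p hp
        rw [Function.mem_support, Function.uncurry_apply_pair] at hp
        change ((χ (Uof p.1) : ℝ) : ℂ) * f₁ (((y, Uof p.1), Tg (Tg (cw 0))), Xof (cw 0) p.2) ≠ 0 at hp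
        refine Set.mk_mem_prod (Set.mem_univ_pi.2 fun j => h𝒦' j _ ?_) ?_
        · rw [Set.mem_preimage, Metric.mem_closedBall, dist_zero_right]
          exact (norm_le_pi_norm (Uof p.1) j).trans (hχR _ fun h0 => hp (by rw [h0, Complex.ofReal_zero, zero_mul]))
        · by_contra hX
          exact hp (by rw [hf₁C _ _ _ hX, mul_zero])
    /- (5): the inner quotient integral is the induction hypothesis' left-hand side at the parameter `((y, Tg (cw 0)), X_h)` -/
    have hIH : ∀ h : ↥(unitaryGroupOfForm (starRingEnd ℂ) J),
        ∫ z', Ξ₂ ((((y, Tg (cw 0)), Xof (cw 0) h)), Uof z') ∂(Measure.pi fun j => qμ ((0 : Fin (m + 1)).succAbove j)) =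
        K₂ * ∫ h' : Fin m → ↥(unitaryGroupOfForm (starRingEnd ℂ) J),
          f₂ ((((y, Tg (cw 0)), Xof (cw 0) h), fun j => cw ((0 : Fin (m + 1)).succAbove j)), fun j => Xof (cw ((0 : Fin (m + 1)).succAbove j)) (h' j))
            ∂(Measure.pi fun _ => μ₀) :=
      fun h => hid₂ ((y, Tg (cw 0)), Xof (cw 0) h) ⟨⟨hy, Set.mem_univ _⟩, Set.mem_univ _⟩ _ hcw' hreg'
    /- (6): insert the cut-off `ψ₁(X_h)` (`= 1` on `C₁`; off `C₁` the induction hypothesis' left side vanishes identically) -/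
    have hψins : ∀ h : ↥(unitaryGroupOfForm (starRingEnd ℂ) J),
        K₂ * ∫ h' : Fin m → ↥(unitaryGroupOfForm (starRingEnd ℂ) J),
          f₂ ((((y, Tg (cw 0)), Xof (cw 0) h), fun j => cw ((0 : Fin (m + 1)).succAbove j)), fun j => Xof (cw ((0 : Fin (m + 1)).succAbove j)) (h' j))
            ∂(Measure.pi fun _ => μ₀) = K₂ * ∫ h', F h h' ∂(Measure.pi fun _ => μ₀) := by
      intro h
      by_cases hXh : Xof (cw 0) h ∈ C₁
      · congr 1
        refine integral_congr_ae (Filter.Eventually.of_forall fun h' => ?_)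
        show _ = ((ψ₁ (Xof (cw 0) h) : ℝ) : ℂ) * _
        rw [hψ₁1 _ hXh, Complex.ofReal_one, one_mul]
      · have h0 : K₂ * ∫ h' : Fin m → ↥(unitaryGroupOfForm (starRingEnd ℂ) J),
            f₂ ((((y, Tg (cw 0)), Xof (cw 0) h), fun j => cw ((0 : Fin (m + 1)).succAbove j)), fun j => Xof (cw ((0 : Fin (m + 1)).succAbove j)) (h' j))
              ∂(Measure.pi fun _ => μ₀) = 0 := by
          rw [← hIH h]
          refine integral_eq_zero_of_ae (Filter.Eventually.of_forall fun z' => ?_)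
          show ((χ (Uof z') : ℝ) : ℂ) * f₁ (((y, Uof z'), Tg (Tg (cw 0))), Xof (cw 0) h) = 0
          rw [hf₁C _ _ _ hXh, mul_zero]
        rw [h0]
        show (0 : ℂ) = K₂ * ∫ h', ((ψ₁ (Xof (cw 0) h) : ℝ) : ℂ) * f₂ ((((y, Tg (cw 0)), Xof (cw 0) h), fun j => cw ((0 : Fin (m + 1)).succAbove j)),
          fun j => Xof (cw ((0 : Fin (m + 1)).succAbove j)) (h' j)) ∂(Measure.pi fun _ => μ₀)
        rw [integral_const_mul, mul_left_comm, h0, mul_zero]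
    /- (7): Fubini back on `U(J) × U(J)^m ≃ U(J)^{m+1}` (integrability: `ψ₁` and `f₂`'s matrix support + properness in `U(J)`) -/
    have hFint : Integrable (fun p : ↥(unitaryGroupOfForm (starRingEnd ℂ) J) × (Fin m → ↥(unitaryGroupOfForm (starRingEnd ℂ) J)) => F p.1 p.2)
        (μ₀.prod (Measure.pi fun _ => μ₀)) := by
      refine Continuous.integrable_of_hasCompactSupport ?_ (HasCompactSupport.of_support_subset_isCompact
        ((hXprop' 0 _ (isCompact_closedBall (0 : Matrix (Fin 2) (Fin 2) ℂ) R₁)).prod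
          (isCompact_univ_pi fun j => hXprop' ((0 : Fin (m + 1)).succAbove j) _ (hC₂.image (continuous_apply j)))) ?_)
      · show Continuous fun p : ↥(unitaryGroupOfForm (starRingEnd ℂ) J) × (Fin m → ↥(unitaryGroupOfForm (starRingEnd ℂ) J)) =>
          ((ψ₁ (Xof (cw 0) p.1) : ℝ) : ℂ) * f₂ ((((y, Tg (cw 0)), Xof (cw 0) p.1), fun j => cw ((0 : Fin (m + 1)).succAbove j)),
            fun j => Xof (cw ((0 : Fin (m + 1)).succAbove j)) (p.2 j))
        exact (Complex.continuous_ofReal.comp (hψ₁s.continuous.comp ((hXofc _).comp continuous_fst))).mul (hf₂s.continuous.comp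
          (((continuous_const.prodMk ((hXofc _).comp continuous_fst)).prodMk continuous_const).prodMk
            (continuous_pi fun j => (hXofc _).comp ((continuous_apply j).comp continuous_snd))))
      · intro p hp
        rw [Function.mem_support] at hp
        change ((ψ₁ (Xof (cw 0) p.1) : ℝ) : ℂ) * f₂ ((((y, Tg (cw 0)), Xof (cw 0) p.1), fun j => cw ((0 : Fin (m + 1)).succAbove j)),
          fun j => Xof (cw ((0 : Fin (m + 1)).succAbove j)) (p.2 j)) ≠ 0 at hp
        refine Set.mk_mem_prod ?_ (Set.mem_univ_pi.2 fun j => ?_)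
        · show Xof (cw 0) p.1 ∈ Metric.closedBall (0 : Matrix (Fin 2) (Fin 2) ℂ) R₁
          rw [Metric.mem_closedBall, dist_zero_right]
          exact hψ₁R _ fun h0 => hp (by rw [h0, Complex.ofReal_zero, zero_mul])
        · show Xof (cw ((0 : Fin (m + 1)).succAbove j)) (p.2 j) ∈ (fun X : Fin m → Matrix (Fin 2) (Fin 2) ℂ => X j) '' C₂
          have hX : (fun j => Xof (cw ((0 : Fin (m + 1)).succAbove j)) (p.2 j)) ∈ C₂ := by
            by_contra hX; exact hp (by rw [hf₂C _ _ _ hX, mul_zero])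
          exact ⟨_, hX, rfl⟩
    /- ### assembling the chain -/
    calc ∫ z, B y (fun k => cj k (z k)) ∂Measure.pi qμ
        = ∫ z', (∫ x, B y (fun k => cj k (Fin.insertNth (α := fun k : Fin (m + 1) => ↥(archLocal L 3 (Matrix.diagonal α) (e k)) ⧸ chartTorusGLoc L α (e k) S) (0 : Fin (m + 1)) x z' k)) ∂qμ 0) ∂Measure.pi fun j => qμ ((0 : Fin (m + 1)).succAbove j) :=
          integral_pi_eq_integral_integral_insertNth qμ 0 hHint
      _ = ∫ z', K₁ * ∫ h, Ξ₂ ((((y, Tg (cw 0)), Xof (cw 0) h)), Uof z') ∂μ₀ ∂Measure.pi fun j => qμ ((0 : Fin (m + 1)).succAbove j) :=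
          integral_congr_ae (Filter.Eventually.of_forall hinner)
      _ = K₁ * ∫ z', ∫ h, Ξ₂ ((((y, Tg (cw 0)), Xof (cw 0) h)), Uof z') ∂μ₀ ∂Measure.pi fun j => qμ ((0 : Fin (m + 1)).succAbove j) := integral_const_mul _ _
      _ = K₁ * ∫ h, ∫ z', Ξ₂ ((((y, Tg (cw 0)), Xof (cw 0) h)), Uof z') ∂(Measure.pi fun j => qμ ((0 : Fin (m + 1)).succAbove j)) ∂μ₀ := by
          rw [integral_integral_swap hswap_int]
      _ = K₁ * ∫ h, K₂ * ∫ h' : Fin m → ↥(unitaryGroupOfForm (starRingEnd ℂ) J),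
            f₂ ((((y, Tg (cw 0)), Xof (cw 0) h), fun j => cw ((0 : Fin (m + 1)).succAbove j)), fun j => Xof (cw ((0 : Fin (m + 1)).succAbove j)) (h' j))
              ∂(Measure.pi fun _ => μ₀) ∂μ₀ := by
          congr 1
          exact integral_congr_ae (Filter.Eventually.of_forall hIH)
      _ = K₁ * ∫ h, K₂ * ∫ h', F h h' ∂(Measure.pi fun _ => μ₀) ∂μ₀ := by
          congr 1
          exact integral_congr_ae (Filter.Eventually.of_forall hψins)
      _ = K₁ * K₂ * ∫ h, ∫ h', F h h' ∂(Measure.pi fun _ => μ₀) ∂μ₀ := by rw [integral_const_mul, mul_assoc]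
      _ = K₁ * K₂ * ∫ p : ↥(unitaryGroupOfForm (starRingEnd ℂ) J) × (Fin m → ↥(unitaryGroupOfForm (starRingEnd ℂ) J)), F p.1 p.2
            ∂(μ₀.prod (Measure.pi fun _ => μ₀)) := by rw [integral_prod _ hFint]
      _ = K₁ * K₂ * ∫ hh : Fin (m + 1) → ↥(unitaryGroupOfForm (starRingEnd ℂ) J), F (hh 0) (fun j => hh ((0 : Fin (m + 1)).succAbove j))
            ∂(Measure.pi fun _ => μ₀) := by
          rw [← (measurePreserving_piFinSuccAbove (fun _ : Fin (m + 1) => μ₀) 0).integral_comp']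
          rfl

/-! ## §2 An arbitrary finite index type -/

set_option maxHeartbeats 800000 in
/-- **(X-core) L1^ι — HARISH-CHANDRA'S WALL DESCENT AT A FINITE FAMILY OF COMPACT-CHART PLACES, FOR A SMOOTH FAMILY OF TEST FUNCTIONS ON THE PRODUCT GROUP.**
Frame: diagonal `α` with `α_i ≠ 0`; `S` the split-chart label; `e : ι → W` a finite family of compact-chart places (`e i ∉ S`, `e i ∈ splitChartPlaces`, REAL at `e i`;
no injectivity asked); `x₀ : ι → ℝ³` a corner: at every `i` the noncompact-wall coincidence `x₀ i 0 = x₀ i 2` with the middle eigenvalue off (`e^{i x₀ i 1} ≠ e^{i x₀ i 0}`).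
Data: a finite-dimensional real normed parameter space `P`, ANY set `O ⊆ P`, a family `B : P → (Π_i U(α)_{e i}) → ℂ` read through ONE jointly smooth
`Ξ : P × M₃(ℂ)^ι → ℂ` (`B y g = Ξ (y, (↑↑(g i))_i)`), with ONE compact set carrying the `g`-support of `B y` for every `y ∈ O`.  Conclusion: `K ≠ 0`, an open
`V ∋ x₀` and ONE jointly smooth `f : (P × (ℝ³)^ι) × M₂(ℂ)^ι → ℂ`, compactly supported in the matrix variables uniformly, depending on each `cw i` only through `cw i 1`, with
`∫_{Π_i (U(α)_{e i} ⧸ T′_i)} B y ((z_i γ_i(cw i) z_i⁻¹)_i) d(⊗_i ν_{e i} ∕ t_{e i}) = K · ∫_{U(J)^ι} f ((y, cw), (↑↑(h_i · P diag(e^{i cw_i 0}, e^{i cw_i 2}) P⁻¹ · h_i⁻¹))_i) d μ₀^{⊗ι}(h)`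
for every `y ∈ O` and every `cw ∈ V` off the walls (`e^{i cw_i 0} ≠ e^{i cw_i 2}` for all `i`); `γ_i(cw i) = gprimeBlockAt α (e i) S (cw i)`, `T′_i = chartTorusGLoc α (e i) S`,
the `i`-th orbital integrand written through `descConj γ_i T′_i _ id` (★ `descConj_eq_comp`).  §1 transported along `Fintype.equivFin ι`.
[cite: Rogawski1990, §4.12 Lemma 4.12.1 p. 61; §8.2 pp. 119–124] [cite: HarishChandra1970, Part V §4] [cite: Shelstad1979, §4 pp. 22–25] [cite: Folland1995, §2.6 (2.52)] -/
theorem exists_descent_box_local_param_pi (hα : ∀ i, α i ≠ 0) {ι : Type} [Fintype ι] (e : ι → {w : InfinitePlace L // IsComplex w})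
    (hreal : ∀ (i : ι) (j : Fin 3), ((e i).1.embedding (α j)).im = 0)
    {J : Matrix (Fin 2) (Fin 2) ℂ} (hJ : J = (StdForm.antidiagonal 2).over ℂ)
    [MeasurableSpace ↥(unitaryGroupOfForm (starRingEnd ℂ) J)] [BorelSpace ↥(unitaryGroupOfForm (starRingEnd ℂ) J)]
    [LocallyCompactSpace ↥(unitaryGroupOfForm (starRingEnd ℂ) J)] [SecondCountableTopology ↥(unitaryGroupOfForm (starRingEnd ℂ) J)]
    (μ₀ : Measure ↥(unitaryGroupOfForm (starRingEnd ℂ) J)) [μ₀.IsHaarMeasure] [μ₀.IsMulRightInvariant]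
    (he : ∀ i, e i ∉ S) (hesp : ∀ i, e i ∈ splitChartPlaces L α)
    {x₀ : ι → Fin 3 → ℝ} (hx02 : ∀ i, x₀ i 0 = x₀ i 2) (hx1 : ∀ i, Circle.exp (x₀ i 1) ≠ Circle.exp (x₀ i 0))
    {P : Type} [NormedAddCommGroup P] [NormedSpace ℝ P] [FiniteDimensional ℝ P] {O : Set P}
    (B : P → (∀ i, ↥(archLocal L 3 (Matrix.diagonal α) (e i))) → ℂ) (Ξ : P × (ι → Matrix (Fin 3) (Fin 3) ℂ) → ℂ) (hΞ : ContDiff ℝ ∞ Ξ)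
    (hBΞ : ∀ y g, B y g = Ξ (y, fun i => ((g i : GL (Fin 3) ℂ) : Matrix (Fin 3) (Fin 3) ℂ)))
    (hBsupp : ∃ C : Set (∀ i, ↥(archLocal L 3 (Matrix.diagonal α) (e i))), IsCompact C ∧ ∀ y ∈ O, ∀ g ∉ C, B y g = 0) :
    ∃ (K : ℂ) (V : Set (ι → Fin 3 → ℝ)) (f : (P × (ι → Fin 3 → ℝ)) × (ι → Matrix (Fin 2) (Fin 2) ℂ) → ℂ),
      K ≠ 0 ∧ IsOpen V ∧ x₀ ∈ V ∧ ContDiff ℝ ∞ f ∧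
      (∃ C : Set (ι → Matrix (Fin 2) (Fin 2) ℂ), IsCompact C ∧ ∀ y cw X, X ∉ C → f ((y, cw), X) = 0) ∧
      (∀ y cw X, f ((y, cw), X) = f ((y, fun i => ![0, cw i 1, 0]), X)) ∧
      ∀ y ∈ O, ∀ cw ∈ V, (∀ i, Circle.exp (cw i 0) ≠ Circle.exp (cw i 2)) →
        ∫ z : (∀ i, ↥(archLocal L 3 (Matrix.diagonal α) (e i)) ⧸ chartTorusGLoc L α (e i) S),
            B y (fun i => descConj (gprimeBlockAt L α (e i) S (cw i)) (chartTorusGLoc L α (e i) S) (forall_mem_chartTorusGLoc_comm L α (e i) S (cw i)) id (z i))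
            ∂(Measure.pi fun i => quotientMeasure (chartTorusGLoc L α (e i) S) (t₀ (e i)) (isClosed_chartTorusGLoc L α (e i) S) (ν₀ (e i))) =
          K * ∫ h : ι → ↥(unitaryGroupOfForm (starRingEnd ℂ) J),
            f ((y, cw), fun i => (((h i * ⟨Matrix.GeneralLinearGroup.mkOfDetNeZero !![(1 : ℂ), 1; 1, -1] det_cayleyTwo_ne_zero *
                circleDiagonal 2 ![Circle.exp (cw i 0), Circle.exp (cw i 2)] *
                (Matrix.GeneralLinearGroup.mkOfDetNeZero !![(1 : ℂ), 1; 1, -1] det_cayleyTwo_ne_zero)⁻¹,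
              cayley_conj_circleDiagonal_mem_of_eq_over hJ _⟩ * (h i)⁻¹ : ↥(unitaryGroupOfForm (starRingEnd ℂ) J)) : GL (Fin 2) ℂ) : Matrix (Fin 2) (Fin 2) ℂ))
            ∂(Measure.pi fun _ => μ₀) := by
  obtain ⟨C, hC, hBC⟩ := hBsupp
  -- the reindexing `τ : Fin m ≃ ι`
  let τ : Fin (Fintype.card ι) ≃ ι := (Fintype.equivFin ι).symm
  -- abbreviations
  let Tc : (Fin 3 → ℝ) → ↥(unitaryGroupOfForm (starRingEnd ℂ) J) := fun cw =>
    ⟨Matrix.GeneralLinearGroup.mkOfDetNeZero !![(1 : ℂ), 1; 1, -1] det_cayleyTwo_ne_zero * circleDiagonal 2 ![Circle.exp (cw 0), Circle.exp (cw 2)] *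
        (Matrix.GeneralLinearGroup.mkOfDetNeZero !![(1 : ℂ), 1; 1, -1] det_cayleyTwo_ne_zero)⁻¹, cayley_conj_circleDiagonal_mem_of_eq_over hJ _⟩
  let Xof : (Fin 3 → ℝ) → ↥(unitaryGroupOfForm (starRingEnd ℂ) J) → Matrix (Fin 2) (Fin 2) ℂ := fun cw h =>
    (((h * Tc cw * h⁻¹ : ↥(unitaryGroupOfForm (starRingEnd ℂ) J)) : GL (Fin 2) ℂ) : Matrix (Fin 2) (Fin 2) ℂ)
  let coeM : ∀ i : ι, ↥(archLocal L 3 (Matrix.diagonal α) (e i)) → Matrix (Fin 3) (Fin 3) ℂ := fun i g => ((g : GL (Fin 3) ℂ) : Matrix (Fin 3) (Fin 3) ℂ)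
  -- the group-side reindexing (the FORWARD direction of `Equiv.piCongrLeft` carries casts; we only evaluate it at `τ k` or transport compact sets along it)
  let ΦG : (∀ k : Fin (Fintype.card ι), ↥(archLocal L 3 (Matrix.diagonal α) (e (τ k)))) ≃ₜ (∀ i, ↥(archLocal L 3 (Matrix.diagonal α) (e i))) :=
    Homeomorph.piCongrLeft (Y := fun i => ↥(archLocal L 3 (Matrix.diagonal α) (e i))) τ
  -- the transported family
  let B' : P → (∀ k : Fin (Fintype.card ι), ↥(archLocal L 3 (Matrix.diagonal α) (e (τ k)))) → ℂ := fun y g' => B y (ΦG g')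
  let Ξ' : P × (Fin (Fintype.card ι) → Matrix (Fin 3) (Fin 3) ℂ) → ℂ := fun q => Ξ (q.1, fun i => q.2 (τ.symm i))
  have hΞ' : ContDiff ℝ ∞ Ξ' :=
    hΞ.comp (contDiff_fst.prodMk (contDiff_pi.2 fun i => (contDiff_apply ℝ (Matrix (Fin 3) (Fin 3) ℂ) (τ.symm i)).comp contDiff_snd))
  have hnat : ∀ g' : ∀ k : Fin (Fintype.card ι), ↥(archLocal L 3 (Matrix.diagonal α) (e (τ k))),
      (fun i => coeM i (ΦG g' i)) = fun i => coeM (τ (τ.symm i)) (g' (τ.symm i)) := by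
    intro g'
    funext i
    obtain ⟨k, rfl⟩ := τ.surjective i
    show coeM (τ k) (Equiv.piCongrLeft (fun i => ↥(archLocal L 3 (Matrix.diagonal α) (e i))) τ g' (τ k)) = _
    rw [Equiv.piCongrLeft_apply_apply, Equiv.symm_apply_apply]
  have hB'Ξ' : ∀ y g', B' y g' = Ξ' (y, fun k => ((g' k : GL (Fin 3) ℂ) : Matrix (Fin 3) (Fin 3) ℂ)) := by
    intro y g'
    show B y (ΦG g') = Ξ (y, fun i => ((g' (τ.symm i) : GL (Fin 3) ℂ) : Matrix (Fin 3) (Fin 3) ℂ))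
    rw [hBΞ]
    exact congrArg (fun U => Ξ (y, U)) (hnat g')
  have hB'supp : ∃ C' : Set (∀ k : Fin (Fintype.card ι), ↥(archLocal L 3 (Matrix.diagonal α) (e (τ k)))), IsCompact C' ∧ ∀ y ∈ O, ∀ g' ∉ C', B' y g' = 0 :=
    ⟨ΦG ⁻¹' C, ΦG.isCompact_preimage.2 hC, fun y hy g' hg' => hBC y hy _ hg'⟩
  obtain ⟨K, V', f', hK, hV'o, hx₀V', hf's, ⟨C', hC', hf'C⟩, hf't, hid⟩ :=
    exists_descent_box_local_param_fin L α S ν₀ t₀ hα hJ μ₀ (Fintype.card ι) (fun k => e (τ k)) (fun k => hreal _) (fun k => he _) (fun k => hesp _)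
      (fun k => x₀ (τ k)) (fun k => hx02 _) (fun k => hx1 _) O B' Ξ' hΞ' hB'Ξ' hB'supp
  -- the matrix-side reindexing `X ↦ X ∘ τ` is a homeomorphism `(ι → M₂) ≃ₜ (Fin m → M₂)` (the SYMMETRIC direction of `piCongrLeft`, cast-free)
  let ΨM : (Fin (Fintype.card ι) → Matrix (Fin 2) (Fin 2) ℂ) ≃ₜ (ι → Matrix (Fin 2) (Fin 2) ℂ) := Homeomorph.piCongrLeft (Y := fun _ => Matrix (Fin 2) (Fin 2) ℂ) τ
  have hΨM : ∀ X : ι → Matrix (Fin 2) (Fin 2) ℂ, ΨM.symm X = fun k => X (τ k) := fun X => funext fun k => Equiv.piCongrLeft_symm_apply _ _ X k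
  refine ⟨K, (fun cw : ι → Fin 3 → ℝ => fun k => cw (τ k)) ⁻¹' V', fun q => f' ((q.1.1, fun k => q.1.2 (τ k)), fun k => q.2 (τ k)), hK,
    hV'o.preimage (continuous_pi fun k => continuous_apply _), hx₀V',
    hf's.comp ((contDiff_fst.comp contDiff_fst).prodMk (contDiff_pi.2 fun k => (contDiff_apply ℝ (Fin 3 → ℝ) (τ k)).comp (contDiff_snd.comp contDiff_fst))
      |>.prodMk (contDiff_pi.2 fun k => (contDiff_apply ℝ (Matrix (Fin 2) (Fin 2) ℂ) (τ k)).comp contDiff_snd)),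
    ⟨ΨM.symm ⁻¹' C', ΨM.symm.isCompact_preimage.2 hC', fun y cw X hX => hf'C _ _ _ (by rwa [Set.mem_preimage, hΨM] at hX)⟩,
    fun y cw X => hf't _ _ _, fun y hy cw hcw hreg => ?_⟩
  -- ### the identity: transport both integrals along `MeasurableEquiv.piCongrLeft _ τ`
  let cj : ∀ i : ι, (↥(archLocal L 3 (Matrix.diagonal α) (e i)) ⧸ chartTorusGLoc L α (e i) S) → ↥(archLocal L 3 (Matrix.diagonal α) (e i)) :=
    fun i => descConj (gprimeBlockAt L α (e i) S (cw i)) (chartTorusGLoc L α (e i) S) (forall_mem_chartTorusGLoc_comm L α (e i) S (cw i)) id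
  let qμ : ∀ i : ι, Measure (↥(archLocal L 3 (Matrix.diagonal α) (e i)) ⧸ chartTorusGLoc L α (e i) S) := fun i =>
    quotientMeasure (chartTorusGLoc L α (e i) S) (t₀ (e i)) (isClosed_chartTorusGLoc L α (e i) S) (ν₀ (e i))
  haveI : ∀ w : {w : InfinitePlace L // IsComplex w}, IsClosed (chartTorusGLoc L α w S : Set ↥(archLocal L 3 (Matrix.diagonal α) w)) :=
    fun w => isClosed_chartTorusGLoc L α w S
  haveI : ∀ w : {w : InfinitePlace L // IsComplex w}, SecondCountableTopology (↥(archLocal L 3 (Matrix.diagonal α) w) ⧸ chartTorusGLoc L α w S) :=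
    fun w => inferInstance
  haveI hσ : ∀ i, SigmaFinite (qμ i) := fun i => by
    show SigmaFinite (quotientMeasure _ _ _ _); infer_instance
  have hΦQ := measurePreserving_piCongrLeft (α := fun i => ↥(archLocal L 3 (Matrix.diagonal α) (e i)) ⧸ chartTorusGLoc L α (e i) S) (μ := qμ) τ
  have hΦU := measurePreserving_piCongrLeft (α := fun _ : ι => ↥(unitaryGroupOfForm (starRingEnd ℂ) J)) (μ := fun _ => μ₀) τ
  -- naturality of `piCongrLeft` with respect to the fibrewise orbit maps
  have hnatQ : ∀ z' : ∀ k : Fin (Fintype.card ι), ↥(archLocal L 3 (Matrix.diagonal α) (e (τ k))) ⧸ chartTorusGLoc L α (e (τ k)) S,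
      (fun i => cj i (MeasurableEquiv.piCongrLeft (fun i => ↥(archLocal L 3 (Matrix.diagonal α) (e i)) ⧸ chartTorusGLoc L α (e i) S) τ z' i)) =
        ΦG (fun k => cj (τ k) (z' k)) := by
    intro z'
    funext i
    obtain ⟨k, rfl⟩ := τ.surjective i
    rw [MeasurableEquiv.piCongrLeft_apply_apply]
    exact (Equiv.piCongrLeft_apply_apply (P := fun i => ↥(archLocal L 3 (Matrix.diagonal α) (e i))) (e := τ) (fun k => cj (τ k) (z' k)) k).symm
  have hL := hid y hy (fun k => cw (τ k)) hcw (fun k => hreg _)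
  calc ∫ z, B y (fun i => cj i (z i)) ∂Measure.pi qμ
      = ∫ z', B y (fun i => cj i (MeasurableEquiv.piCongrLeft (fun i => ↥(archLocal L 3 (Matrix.diagonal α) (e i)) ⧸ chartTorusGLoc L α (e i) S) τ z' i))
          ∂Measure.pi fun k => qμ (τ k) := (hΦQ.integral_comp' _).symm
    _ = ∫ z', B' y (fun k => cj (τ k) (z' k)) ∂Measure.pi fun k => qμ (τ k) := by
        refine integral_congr_ae (Filter.Eventually.of_forall fun z' => ?_)
        show B y _ = B y (ΦG _)
        rw [hnatQ]
    _ = K * ∫ h' : Fin (Fintype.card ι) → ↥(unitaryGroupOfForm (starRingEnd ℂ) J), f' ((y, fun k => cw (τ k)), fun k => Xof (cw (τ k)) (h' k)) ∂Measure.pi fun _ => μ₀ := hL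
    _ = K * ∫ h : ι → ↥(unitaryGroupOfForm (starRingEnd ℂ) J), f' ((y, fun k => cw (τ k)), fun k => Xof (cw (τ k)) (h (τ k))) ∂Measure.pi fun _ => μ₀ := by
        congr 1
        rw [← hΦU.integral_comp']
        refine integral_congr_ae (Filter.Eventually.of_forall fun h' => ?_)
        dsimp only
        congr 2
        funext k
        rw [MeasurableEquiv.piCongrLeft_apply_apply]

end LocalPi

end Literature.NumberTheory.Rogawski1990

end
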